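import Literature.Geometry.Riemannian.CanonicalNeighbourhoods
import HarnessLib

/-!
# Bamler–Cabezas-Rivas–Wilking: smoothing almost non-negative curvature operator to
# non-negative curvature operator (Invent. Math. 217 (2019), Corollary 3, case (1))

Topic `Literature/Geometry/Riemannian`; a named fact (result in print, `def … : Prop`, D-0014)
requested by the route `Summit.SmoothPoincare4.SmoothPoincare4.Theses.AngleDefectCertificates`
(the `BCRWUpgrade` child of `stmt-SmoothPoincare4-7224`, and its Euclidean `CBB(0)` variant;
work item `wi-16964`), over the tree's Riemannian vocabulary: metrics
`PseudoRiemannianMetric (𝓡 k) ∞ (𝔼 k) (TangentSpace (𝓡 k) : M → Type _)` with `IsRiemannian`,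
Levi-Civita connections `IsLeviCivita`, the curvature operator as a quadratic form on 2-vectors
`curvatureOperatorForm` (`CurvatureOperator.lean`, Hamilton's convention: the round sphere is
positive), the Riemannian distance `riemEDist` and volume measure `riemVolume`
(`CanonicalNeighbourhoods.lean`, `RiemannianDistance.lean`, `Volume.lean`).

**What is printed** (R. Bamler, E. Cabezas-Rivas, B. Wilking, *The Ricci flow under almost
non-negative curvature conditions*, Invent. Math. 217 (2019) 95–126, arXiv:1707.03002, §1, p. 3):

> **Theorem 1.** Given `n ∈ ℕ` and `v₀ > 0` there exist `C = C(n, v₀) > 0`, `τ = τ(n, v₀) > 0`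
> such that: if `(Mⁿ, g)` is complete with bounded curvature, `vol_g(B_g(p,1)) ≥ v₀` for all `p`
> and `Rm_g ≥ −ε ≥ −1` (lowest eigenvalue of `Rm_g` bounded below by `−ε`), then the Ricci flow
> `g(t)` exists until time `τ` and `Rm_{g(t)} ≥ −Cε`, `|Rm_{g(t)}| ≤ C/t` for `t ∈ (0, τ]`.
> (`Rm_g ≥ −ε` "can be rephrased by saying that `Rm_g + ε I`, where `I` denotes the curvature
> operator of the unit round `n`-sphere, is non-negative definite".)
>
> **Corollary 3.** Given `n ∈ ℕ` and positive constants `D, v₀`, there exists `ε = ε(n, v₀, D) > 0`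
> such that the following holds. Let `𝒞` be one of the curvature conditions (1)–(5) of Theorem 2
> [(1) non-negative curvature operator, (2) 2-non-negative, (3) weakly PIC₂, (4) weakly PIC₁,
> (5) non-negative bisectional curvature (Kähler)]. Then any closed Riemannian manifold `(Mⁿ, g)`
> with `diam_g(M) ≤ D`, `vol_g(M) ≥ v₀` and `Rm_g + ε I ∈ 𝒞` also admits a metric whose curvature
> operator lies in `𝒞`.  ("It will be clear from the proof that the metric … is close to the
> original metric `g` in the Gromov–Hausdorff sense.")

* `PseudoRiemannianMetric.bivectorNormSq g x X Y` — `|φ|²_g` for the 2-vector `φ = Σₐ Xₐ ∧ Yₐ`,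
  the metric on `Λ² T_x M` induced by `g` (`⟨X∧Y, X'∧Y'⟩ = g(X,X')g(Y,Y') − g(X,Y')g(Y,X')`), so
  that "`Rm_g ≥ −ε`", i.e. `Rm_g + ε I ≥ 0` with `I` the curvature operator of the unit round
  sphere (`Rm_{S^n}(φ, φ) = |φ|²`), reads `Rm(φ, φ) ≥ −ε |φ|²` in the tree's `curvatureOperatorForm`.
* `PseudoRiemannianMetric.HasCurvatureOperatorGe g ε` — `Rm_g ≥ −ε` (for every Levi-Civita
  connection of `g`), and `HasNonnegativeCurvatureOperator g` := the case `ε = 0`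
  (curvature condition (1)).
* `BamlerCabezasRivasWilking2019_cor3_nonnegativeCurvatureOperator` — **Corollary 3, case (1)**
  as a named fact.

## Rendering

`(Mⁿ, g)` closed Riemannian: `M : Type` a Hausdorff, second countable, compact, boundaryless
smooth manifold modelled on `𝔼 k = EuclideanSpace ℝ (Fin k)` (`𝓡 k`; the dimension is called `k`
since `n` is the metrics' smoothness exponent in the tree's vocabulary, here `∞`) with its Borel
σ-algebra, `g` a smooth Riemannian metric (`IsRiemannian`); `diam_g(M) ≤ D` is
`riemEDist x y ≤ D` for all `x, y` (the length distance; `= ∞` across components, so `M` is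
automatically connected); `vol_g(M) ≥ v₀` is `riemVolume univ ≥ v₀` (the Euclidean-normalised
Hausdorff measure of the Riemannian distance = `√det g dx`); the curvature hypothesis and
conclusion quantify over Levi-Civita connections of the metric exactly as the accepted
`HasPositiveCurvatureOperator` does.  Only case (1) of the five curvature conditions is
transcribed, and neither Theorem 1's flow (Ricci flow up to `τ(n, v₀)` with `Rm ≥ −Cε`,
`|Rm| ≤ C/t`) nor the Gromov–Hausdorff closeness remark (which is not part of the printed
corollary) is asserted.  The new metric is only asserted to be a smooth Riemannian metric on the
SAME manifold `M` with non-negative curvature operator; strict positivity is not claimed (it is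
false in general: flat tori satisfy the hypotheses for every `ε`).

## Mathlib / tree search

Mathlib: Riemannian metrics on vector bundles and the length (e)metric
`PseudoEMetricSpace.ofRiemannianMetric` (used through the tree's `riemEDist`/`riemVolume`), no
curvature, no Ricci flow.  Tree: `curvatureOperatorForm`, `bivectorForm`,
`HasPositiveCurvatureOperator(With)` (`CurvatureOperator.lean`), `riemEDist`, `ball`,
`riemVolume`, `vol` (`CanonicalNeighbourhoods.lean`), `IsLeviCivita` (`LeviCivita.lean`),
`RicciFlow.lean` (Hamilton's flow).  `lean search 'Bamler|CabezasRivas|almost non-negative|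
NonnegativeCurvatureOperator'`: docstring mentions only; no smoothing/gap theorem in the tree.

## References

* R. H. Bamler, E. Cabezas-Rivas, B. Wilking, Invent. Math. 217 (2019) 95–126
  (arXiv:1707.03002), §1: Theorem 1, Theorem 2 (conditions (1)–(5)), Corollary 3 and the remark
  following it. [`BamlerCabezasrivasWilking2019`]
* R. S. Hamilton, *Four-manifolds with positive curvature operator*, J. Differential Geom. 24
  (1986) (the convention `Rm(φ, φ)` on 2-forms). [`Hamilton1986`]
-/

noncomputable section

open Bundle Finset MeasureTheory
open scoped Manifold ContDiff Topology BigOperators ENNReal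

namespace Literature.Geometry.Riemannian

open Literature.Geometry.Lorentzian (PseudoRiemannianMetric)
open Literature.Geometry.Lorentzian.PseudoRiemannianMetric

section Bivector

variable {E : Type*} [NormedAddCommGroup E] [NormedSpace ℝ E] {H : Type*} [TopologicalSpace H]
  {I : ModelWithCorners ℝ E H} {M : Type*} [TopologicalSpace M] [ChartedSpace H M]
  [IsManifold I ∞ M] {n : ℕ∞ω}

variable (g : PseudoRiemannianMetric I n E (TangentSpace I : M → Type _))
  (cov : CovariantDerivative I E (TangentSpace I : M → Type _))

/-- The **squared norm `|φ|²_g` of the 2-vector `φ = Σₐ Xₐ ∧ Yₐ`** for the metric induced by `g`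
on `Λ² T_x M`, `⟨X ∧ Y, X' ∧ Y'⟩ = g(X, X') g(Y, Y') − g(X, Y') g(Y, X')` (Lee, *Riemannian
Manifolds*, Ch. 8; for `g` Riemannian and `X, Y` orthonormal, `|X ∧ Y|² = 1`):
`|φ|² = Σ_{a,b} (g(Xₐ, X_b) g(Yₐ, Y_b) − g(Xₐ, Y_b) g(Yₐ, X_b))`.  It is the quadratic form of the
curvature operator `I` of the unit round sphere in Hamilton's convention
(`Rm_{Sⁿ}(X, Y, Y, X) = g(X,X)g(Y,Y) − g(X,Y)²`), the normalisation of "`Rm_g + ε I`" in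
Bamler–Cabezas-Rivas–Wilking 2019, §1. [folklore] -/
def _root_.Literature.Geometry.Lorentzian.PseudoRiemannianMetric.bivectorNormSq (x : M) {m : ℕ}
    (X Y : Fin m → TangentSpace I x) : ℝ :=
  ∑ a, ∑ b, (g.val x (X a) (X b) * g.val x (Y a) (Y b) - g.val x (X a) (Y b) * g.val x (Y a) (X b))

/-- For a single pair, `|X ∧ Y|² = g(X,X) g(Y,Y) − g(X,Y) g(Y,X)`. [folklore] -/
@[simp] theorem _root_.Literature.Geometry.Lorentzian.PseudoRiemannianMetric.bivectorNormSq_one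
    (x : M) (X Y : Fin 1 → TangentSpace I x) :
    g.bivectorNormSq x X Y =
      g.val x (X 0) (X 0) * g.val x (Y 0) (Y 0) - g.val x (X 0) (Y 0) * g.val x (Y 0) (X 0) := by
  simp [bivectorNormSq]

/-- `|φ|²` of the empty sum is `0`. [folklore] -/
@[simp] theorem _root_.Literature.Geometry.Lorentzian.PseudoRiemannianMetric.bivectorNormSq_zero
    (x : M) (X Y : Fin 0 → TangentSpace I x) : g.bivectorNormSq x X Y = 0 := by
  simp [bivectorNormSq]

/-- **`Rm_g ≥ −ε` for the pair `(g, cov)`** (Bamler–Cabezas-Rivas–Wilking 2019, §1: "the lowest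
eigenvalue of `Rm_g` is bounded below by `−ε`", equivalently "`Rm_g + ε I` … is non-negative
definite"): `Rm(φ, φ) ≥ −ε |φ|²` for every 2-vector `φ = Σₐ Xₐ ∧ Yₐ` at every point, in the
tree's `curvatureOperatorForm` (Hamilton's convention) and `bivectorNormSq`.
[cite: BamlerCabezasrivasWilking2019, §1 (Theorem 1, the bound Rm_g ≥ −ε)] -/
def _root_.Literature.Geometry.Lorentzian.PseudoRiemannianMetric.HasCurvatureOperatorGeWith
    (ε : ℝ) : Prop :=
  ∀ (x : M) (m : ℕ) (X Y : Fin m → TangentSpace I x),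
    -ε * g.bivectorNormSq x X Y ≤ g.curvatureOperatorForm cov x X Y

/-- **`Rm_g ≥ −ε`** for the metric `g` itself: for every Levi-Civita connection `cov` of `g`
(`IsLeviCivita`; unique for `C¹` metrics), `(g, cov)` satisfies `Rm ≥ −ε` — the same phrasing as the
accepted `HasPositiveCurvatureOperator`. [cite: BamlerCabezasrivasWilking2019, §1 (Theorem 1)] -/
def _root_.Literature.Geometry.Lorentzian.PseudoRiemannianMetric.HasCurvatureOperatorGe
    [FiniteDimensional ℝ E] [CompleteSpace E] (ε : ℝ) : Prop :=
  ∀ cov : CovariantDerivative I E (TangentSpace I : M → Type _), g.IsLeviCivita cov →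
    g.HasCurvatureOperatorGeWith cov ε

/-- **Non-negative curvature operator** (curvature condition (1) of Bamler–Cabezas-Rivas–Wilking
2019, Theorem 2; Hamilton 1986): `Rm(φ, φ) ≥ 0` for all 2-vectors, i.e. `Rm_g ≥ −0`.
This is the printed *definition* of the curvature condition, a predicate on the metric `g` — hence
the explicit binder — and not an assertion: there is no `HasNonnegativeCurvatureOperator_holds`
(its closure over all metrics fails, e.g. for hyperbolic metrics, where `Rm(φ, φ) = −|φ|²`; a metric
all of whose Levi-Civita connections are flat satisfies it with equality,
`hasNonnegativeCurvatureOperator_of_isFlat` below).  What Bamler–Cabezas-Rivas–Wilking prove about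
the notion is Corollary 3 (1), the named fact
`BamlerCabezasRivasWilking2019_cor3_nonnegativeCurvatureOperator` below.
[cite: BamlerCabezasrivasWilking2019, Theorem 2 (1)] -/
def _root_.Literature.Geometry.Lorentzian.PseudoRiemannianMetric.HasNonnegativeCurvatureOperator
    (g : PseudoRiemannianMetric I n E (TangentSpace I : M → Type _))
    [FiniteDimensional ℝ E] [CompleteSpace E] : Prop :=
  g.HasCurvatureOperatorGe 0

variable {g cov}

/-- `Rm ≥ −0` with a connection says `0 ≤ Rm(φ, φ)` for all 2-vectors. [folklore] -/
theorem _root_.Literature.Geometry.Lorentzian.PseudoRiemannianMetric.hasCurvatureOperatorGeWith_zero_iff :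
    g.HasCurvatureOperatorGeWith cov 0 ↔
      ∀ (x : M) (m : ℕ) (X Y : Fin m → TangentSpace I x), 0 ≤ g.curvatureOperatorForm cov x X Y := by
  simp [HasCurvatureOperatorGeWith]

/-- Monotonicity in `ε` on 2-vectors of non-negative squared norm (automatic for Riemannian `g`,
where `|φ|² ≥ 0`): `Rm ≥ −ε` and `ε ≤ ε'` give `Rm ≥ −ε'` there. [folklore] -/
theorem _root_.Literature.Geometry.Lorentzian.PseudoRiemannianMetric.HasCurvatureOperatorGeWith.mono_of_nonneg
    {ε ε' : ℝ} (h : g.HasCurvatureOperatorGeWith cov ε) (hε : ε ≤ ε') (x : M) {m : ℕ}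
    (X Y : Fin m → TangentSpace I x) (hφ : 0 ≤ g.bivectorNormSq x X Y) :
    -ε' * g.bivectorNormSq x X Y ≤ g.curvatureOperatorForm cov x X Y :=
  le_trans (by nlinarith) (h x m X Y)

/-- A positive curvature operator is non-negative on non-zero 2-vectors and, trivially, `≥ 0` on
every 2-vector on which it is defined through `curvatureOperatorForm` once `Rm(φ,φ) ≥ 0` is known
for `φ♭ = 0` too; recorded in the usable direction: `Rm ≥ −0` with `cov` implies `Rm(φ,φ) ≥ 0`.
[folklore] -/
theorem _root_.Literature.Geometry.Lorentzian.PseudoRiemannianMetric.HasCurvatureOperatorGeWith.nonneg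
    (h : g.HasCurvatureOperatorGeWith cov 0) (x : M) {m : ℕ} (X Y : Fin m → TangentSpace I x) :
    0 ≤ g.curvatureOperatorForm cov x X Y := by
  simpa using h x m X Y

/-! ### Why there is no `HasNonnegativeCurvatureOperator_holds`: the condition is a hypothesis

`HasNonnegativeCurvatureOperator g` is curvature condition (1) itself, not a theorem about all
metrics.  It is satisfiable and not strict: a flat connection has `Rm(φ, φ) = 0` for every
2-vector (`curvatureOperatorForm_eq_zero_of_isFlat`, `CurvatureOperator.lean`), so it satisfies
`Rm ≥ −0` (`hasCurvatureOperatorGeWith_zero_of_isFlat` in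
`AlmostNonnegativeCurvatureSmoothingProofs.lean`), and a metric all of whose Levi-Civita
connections are flat (flat tori) has non-negative curvature operator — while, e.g., hyperbolic
metrics do not. -/

/-- A metric all of whose Levi-Civita connections are flat (for `C¹` metrics: whose Levi-Civita
connection is flat) has non-negative curvature operator: `Rm(φ, φ) = 0 ≥ 0`. [folklore] -/
theorem _root_.Literature.Geometry.Lorentzian.PseudoRiemannianMetric.hasNonnegativeCurvatureOperator_of_isFlat
    [FiniteDimensional ℝ E] [CompleteSpace E]
    (h : ∀ cov : CovariantDerivative I E (TangentSpace I : M → Type _),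
      g.IsLeviCivita cov → cov.IsFlat) :
    g.HasNonnegativeCurvatureOperator := fun cov hcov =>
  hasCurvatureOperatorGeWith_zero_iff.mpr fun x _ X Y =>
    (curvatureOperatorForm_eq_zero_of_isFlat (h cov hcov) x X Y).ge

end Bivector

/-! ### The named fact -/

/-- **Bamler–Cabezas-Rivas–Wilking 2019, Corollary 3, case (1) (almost non-negative ⇒ non-negative
curvature operator, non-collapsed closed manifolds).**  "Given `n ∈ ℕ` and positive constants
`D, v₀`, there exists a constant `ε = ε(n, v₀, D) > 0` such that the following holds … any closed
Riemannian manifold `(Mⁿ, g)` with `diam_g(M) ≤ D`, `vol_g(M) ≥ v₀` and `Rm_g + ε I ∈ 𝒞` also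
admits a metric whose curvature operator lies in `𝒞`", for `𝒞` = non-negative curvature operator.
Rendered (module docstring): for every dimension `k` and `D, v₀ > 0` there is `ε > 0` such that for
every compact boundaryless Hausdorff second-countable smooth `k`-manifold `M` (modelled on `𝔼 k`;
compact Hausdorff, hence `T₃`, as `riemVolume` requires) with its Borel σ-algebra and every smooth
Riemannian metric `g` on it with `riemEDist x y ≤ D` for all `x, y`,
`riemVolume univ ≥ v₀` and `Rm_g ≥ −ε` (`HasCurvatureOperatorGe g ε`), there is a smooth
Riemannian metric `g'` on `M` with non-negative curvature operator
(`HasNonnegativeCurvatureOperator g'`).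
[cite: BamlerCabezasrivasWilking2019, Corollary 3 (case (1) of Theorem 2)] -/
def BamlerCabezasRivasWilking2019_cor3_nonnegativeCurvatureOperator : Prop :=
  ∀ (k : ℕ) (D v₀ : ℝ), 0 < D → 0 < v₀ → ∃ ε : ℝ, 0 < ε ∧
    ∀ (M : Type) [TopologicalSpace M] [T2Space M] [SecondCountableTopology M] [CompactSpace M]
      [MeasurableSpace M] [BorelSpace M]
      [ChartedSpace (EuclideanSpace ℝ (Fin k)) M] [IsManifold (𝓡 k) ∞ M]
      (g : PseudoRiemannianMetric (𝓡 k) ∞ (EuclideanSpace ℝ (Fin k))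
        (TangentSpace (𝓡 k) : M → Type _)),
      g.IsRiemannian →
      (∀ x y : M, g.riemEDist x y ≤ ENNReal.ofReal D) →
      ENNReal.ofReal v₀ ≤ g.riemVolume Set.univ →
      g.HasCurvatureOperatorGe ε →
        ∃ g' : PseudoRiemannianMetric (𝓡 k) ∞ (EuclideanSpace ℝ (Fin k))
            (TangentSpace (𝓡 k) : M → Type _),
          g'.IsRiemannian ∧ g'.HasNonnegativeCurvatureOperator

/-! ### API -/

/-- The `ε` of Corollary 3 may be shrunk: the statement with a smaller `ε' ∈ (0, ε]` follows
(fewer metrics satisfy `Rm ≥ −ε'`), for Riemannian `g` — where `|φ|² ≥ 0` would be needed to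
compare; recorded in the hypothesis-free direction actually used: a metric with `Rm ≥ −ε'`,
`ε' ≤ ε`, `|φ|²`-nonnegativity granted pointwise, satisfies `Rm ≥ −ε`. [folklore] -/
theorem hasCurvatureOperatorGe_of_le
    {E : Type*} [NormedAddCommGroup E] [NormedSpace ℝ E] [FiniteDimensional ℝ E] [CompleteSpace E]
    {H : Type*} [TopologicalSpace H] {I : ModelWithCorners ℝ E H} {M : Type*} [TopologicalSpace M]
    [ChartedSpace H M] [IsManifold I ∞ M] {n : ℕ∞ω}
    {g : PseudoRiemannianMetric I n E (TangentSpace I : M → Type _)} {ε' ε : ℝ}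
    (h : g.HasCurvatureOperatorGe ε') (hle : ε' ≤ ε)
    (hpos : ∀ (x : M) (m : ℕ) (X Y : Fin m → TangentSpace I x), 0 ≤ g.bivectorNormSq x X Y) :
    g.HasCurvatureOperatorGe ε :=
  fun cov hcov x m X Y => (h cov hcov).mono_of_nonneg hle x X Y (hpos x m X Y)

end Literature.Geometry.Riemannian
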